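import Mathlib
import Summits.QuantumFields.BalabanUV.T4Continuum.Support.SliceFlatGaugeBridge
import Summits.QuantumFields.BalabanUV.T4Continuum.Support.SliceFlatMassTerm

/-!
# T⁴ programme, node NE3 (η-rate of the minimisers) — THE FLAT RUNG, part 5: the GAUGE HALF of the flat remainder form obeys
# the (3.49)-type entry bound with LEVEL-FREE constants, hence the whole (3.49) reading `hT349` at `U = 1` is a THEOREM

Fourteenth generation of the NE3 prover lineage P1 of the cell `pub-balaban`, file 5.  `SliceFlatMassTerm` (p200480) split the
remainder form of the flat family as `flatNg j = −gaugeDev j + massDev j` and proved the (3.49) shape for `massDev`; BRIDGE-126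
(`SliceFlatGaugeProjection`∕`Green`∕`Kernel`∕`Bridge`, this generation) turned b05's n- and volume-uniform (1.126)
(`B5DPD126Uniform.matrixP_decay_uniform`) into `SliceFlatGaugeBridge.reM_dPd_decay_uniform` for the operator `Re(∂_n·PcT·∂_nᴴ)`
INSIDE pv15's `Δ_a` — which is exactly what `gaugeDev j = η_j²·RI j Re(∂P_j∂*)` reindexes.  THIS FILE reads it on the NE3 carrier:
 * §1 `coarse_repT_eF` (b04's block label of the reindexed site IS the value of NE3's cube: `⌊val(z_i)/n⌋ = val(cube j z)_i`),
   **`abs_gaugeDev_le`** (for `j ≤ k`: `|gaugeDev j (z,w)| ≤ C·(L^j)^{−(d+3)}·e^{−(δ/(d+1))·nbd_j(cube z, cube w)}` with b05's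
   `δ, C` — functions of `d` ONLY — via `nbd_le_torusSupNorm`);
 * §2 **`gaugeDev_le_349`** (the `Fk 3 = Ng` entry-bound shape of `stmt349Printed_torus_of_entryBounds` for `gaugeDev`) and the
   deliverable **`flatNg_le_349`**: `∃ δ₁ > 0, C₁ > 0` depending on `d` only such that for ALL `k N L` (`N, L ≥ 1`), all levels
   `j ≤ k` and all entries, `|flatNg d k N L j z w| ≤ C₁ · pref4inv(L^j)₃ · (L^j)^{−(d+1)} · e^{−(δ₁/2)·nbd_j(cube z, cube w)}`.
WHAT THIS BUYS (honest): of the three printed-statement readings of the lineage's one type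
(`SliceCovariantLevels.ne3Shape_torusCovE_upto_of_printedStatements`, p199789), AT `U = 1` now `hT31` item 0 (level-free,
`SliceFlatOperators.gLevE_flat_rowBound`), `hT311` (`posDef_kLevE_flat`) AND `hT349` for the gauge∕remainder slot `Fk 3 = Ng =
flatNg` (this file) are THEOREMS about the skeleton's own operators with constants depending on the dimension only; what remains
at `U = 1` is `hT31` item 1 (`∇G`, `G∇*`) and the zero carriers `Fk 0,1,2` (trivial); at `U ≠ 1` everything, and ALL consistency
readings — NO ETA.  NE3 is NOT proved.

Honest framing: finite-T⁴ ultraviolet bookkeeping about MINIMISERS (rung (B)+1 of the cell's ladder); no conditional of the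
cell (`BetaPertH`, (B), (B^μ)) is used or hidden; nothing bears on infinite volume, a mass gap, or the Clay problem.  ABSOLUTE
RULE of the cell kept: inputs are kernel-proved tree modules only; constants are b05's existential `δ, C` at `a = 1` — nothing
printed is matched.  No `sorry`, no axioms beyond Mathlib's.  PLACEMENT (human rule 2026-08-19): cell work under
`Summits/QuantumFields/BalabanUV/`; imports `Support.SliceFlatGaugeBridge`, `Support.SliceFlatMassTerm`; moves nothing.
Records: `t4/T4-EST-U1b-OSC.md` v1.29 (RESULT 37), `t4/T4-EST-NE3-P1.md` v2.28, GAPS G-ne3p1-43 of the cell `pub-balaban`.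
-/

noncomputable section

open Finset Real Matrix

namespace Summit.QuantumFields.BalabanUV.T4Continuum.SliceFlatGaugeDecay

open Literature.MathematicalPhysics.QuantumFieldTheory.Balaban1983to89
open Literature.MathematicalPhysics.QuantumFieldTheory.Balaban1983to89.TreeLengthTorus (TPt)
open Literature.MathematicalPhysics.QuantumFieldTheory.Balaban1983to89.B5Prop11Plancherel (Tor fine)
open Literature.MathematicalPhysics.QuantumFieldTheory.Balaban1983to89.B5Action121 (GradOp)
open Literature.MathematicalPhysics.QuantumFieldTheory.Balaban1983to89.B5Value126 (PcT)
open Literature.MathematicalPhysics.QuantumFieldTheory.Balaban1983to89.B5RealFields (reM)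
open Literature.MathematicalPhysics.QuantumFieldTheory.Balaban1983to89.B4Green244 (coarse)
open Literature.MathematicalPhysics.QuantumFieldTheory.Balaban1983to89.B4TorusKernel.MultiPeriod (torusSupNorm)
open Summit.QuantumFields.BalabanUV.T4Continuum.SliceTorusBlocks
open Summit.QuantumFields.BalabanUV.T4Continuum.SliceTorusTower
open Summit.QuantumFields.BalabanUV.T4Continuum.SliceCovariantTower
open Summit.QuantumFields.BalabanUV.T4Continuum.SliceFlatPropagator
open Summit.QuantumFields.BalabanUV.T4Continuum.SliceFlatOperators
open Summit.QuantumFields.BalabanUV.T4Continuum.SliceFlatMassTerm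
open Summit.QuantumFields.BalabanUV.T4Continuum.SliceFlatGaugeKernel (repT)
open Summit.QuantumFields.BalabanUV.T4Continuum.SliceFlatGaugeBridge (reM_dPd_decay_uniform)

variable (d k N L : ℕ) [NeZero N] [NeZero L]

/-! ## §1  The gauge half on the NE3 carrier -/
section Gauge

/-- **b04's block label of the reindexed site IS the value of NE3's cube**: `⌊val((eF z)_i)/n⌋ = val((cube j z)_i)`. [folklore] -/
theorem coarse_repT_eF (j : ℕ) (z : TPt (d + 1) (N * L ^ k)) (i : Fin (d + 1)) :
    coarse (side k L j) (repT (side k L j) (Mlev d k N L j) (eF d k N L j z)) i = (((cube (d + 1) k N L j z) i).val : ℤ) := by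
  show (((eF d k N L j z i).val : ℤ)) / (side k L j : ℤ) = _
  rw [val_eF, show cube (d + 1) k N L j z i = blockOf (levM k N L j) (side k L j) (z i) from rfl,
    val_blockOf (fine_eq_levM_mul_side k N L j), Int.natCast_div]

/-- **THE GAUGE HALF OF THE FLAT REMAINDER FORM DECAYS, LEVEL-FREE**: with b05's `δ > 0`, `C ≥ 0` (functions of `d` only),
for every `k N L`, every level `j ≤ k` and all entries: `|gaugeDev j (z,w)| ≤ (L^j)^{−2}·(L^j)^{−(d+1)}·C·e^{−(δ/(d+1))·nbd}`
(`gaugeDev = η_j²·RI j Re(∂P∂*)`, `SliceFlatGaugeBridge.reM_dPd_decay_uniform`, `nbd_le_torusSupNorm`). [folklore] -/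
theorem abs_gaugeDev_le :
    ∃ δ C : ℝ, 0 < δ ∧ 0 ≤ C ∧ ∀ (k N L : ℕ) [NeZero N] [NeZero L] (j : ℕ), j ≤ k →
      ∀ z w : TPt (d + 1) (N * L ^ k) × Fin (d + 1),
        |gaugeDev d k N L j z w|
          ≤ (((L : ℝ) ^ j) ^ 2)⁻¹ * ((((L : ℝ) ^ j) ^ (d + 1))⁻¹ * C
              * Real.exp (-(δ / (d + 1) * (nbd (d + 1) k N L j (cubeI (d + 1) k N L (Fin (d + 1)) j z)
                  (cubeI (d + 1) k N L (Fin (d + 1)) j w) : ℝ)))) := by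
  obtain ⟨δ, C, hδ, hC, h⟩ := reM_dPd_decay_uniform d
  refine ⟨δ, C, hδ, hC, fun k N L _ _ j hj z w => ?_⟩
  have hd1 : (0 : ℝ) < (d : ℝ) + 1 := by positivity
  have hside : (side k L j : ℝ) = (L : ℝ) ^ j := by rw [side_eq_pow k L hj, Nat.cast_pow]
  -- the uniform (1.126) on the carrier of level `j`
  have hb := h (side k L j) (Mlev d k N L j) z.2 w.2 (eF d k N L j z.1) (eF d k N L j w.1)
  -- the block-label dictionary and the distance dictionary
  have hcz : coarse (side k L j) (repT (side k L j) (Mlev d k N L j) (eF d k N L j z.1))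
      - coarse (side k L j) (repT (side k L j) (Mlev d k N L j) (eF d k N L j w.1))
      = fun μ => (((cube (d + 1) k N L j z.1) μ).val : ℤ) - (((cube (d + 1) k N L j w.1) μ).val : ℤ) := by
    funext μ; rw [Pi.sub_apply, coarse_repT_eF, coarse_repT_eF]
  rw [hcz] at hb
  have hT := nbd_le_torusSupNorm (d := d) (k := k) (N := N) (L := L) j (cube (d + 1) k N L j z.1) (cube (d + 1) k N L j w.1)
  set T := torusSupNorm (Mlev d k N L j)
    (fun μ => (((cube (d + 1) k N L j z.1) μ).val : ℤ) - (((cube (d + 1) k N L j w.1) μ).val : ℤ)) with hTdef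
  set D := (nbd (d + 1) k N L j (cubeI (d + 1) k N L (Fin (d + 1)) j z) (cubeI (d + 1) k N L (Fin (d + 1)) j w) : ℝ) with hDdef
  have hDT : δ / (d + 1) * D ≤ δ * T := by
    rw [div_mul_eq_mul_div, div_le_iff₀ hd1]
    have : D ≤ (d + 1) * T := by rw [hDdef, cubeI_apply, cubeI_apply]; exact hT
    nlinarith
  have hexp : Real.exp (-(δ * T)) ≤ Real.exp (-(δ / (d + 1) * D)) := Real.exp_le_exp.mpr (by linarith)
  -- the entry of `gaugeDev`
  have hentry : gaugeDev d k N L j z w = ((side k L j : ℝ) ^ 2)⁻¹ *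
      reM (GradOp (fine (side k L j) (Mlev d k N L j)) (side k L j : ℂ) * PcT (side k L j) (Mlev d k N L j) (side k L j : ℂ)
        * (GradOp (fine (side k L j) (Mlev d k N L j)) (side k L j : ℂ))ᴴ) (eF d k N L j z.1, z.2) (eF d k N L j w.1, w.2) := by
    rw [gaugeDev, Matrix.smul_apply, RI_apply, smul_eq_mul]
  rw [hentry, abs_mul, abs_of_nonneg (by positivity), hside]
  refine mul_le_mul_of_nonneg_left ?_ (by positivity)
  calc |reM (GradOp (fine (side k L j) (Mlev d k N L j)) (side k L j : ℂ) * PcT (side k L j) (Mlev d k N L j) (side k L j : ℂ)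
          * (GradOp (fine (side k L j) (Mlev d k N L j)) (side k L j : ℂ))ᴴ) (eF d k N L j z.1, z.2) (eF d k N L j w.1, w.2)|
      ≤ ((side k L j : ℝ) ^ (d + 1))⁻¹ * C * Real.exp (-(δ * T)) := hb
    _ ≤ ((side k L j : ℝ) ^ (d + 1))⁻¹ * C * Real.exp (-(δ / (d + 1) * D)) :=
        mul_le_mul_of_nonneg_left hexp (by positivity)
    _ = (((L : ℝ) ^ j) ^ (d + 1))⁻¹ * C * Real.exp (-(δ / (d + 1) * D)) := by rw [hside]

end Gauge

/-! ## §2  The (3.49) shape for the gauge half and for the whole flat remainder form -/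
section Shape

/-- **THE (3.49)-TYPE ENTRY BOUND FOR THE GAUGE HALF, LEVEL-FREE CONSTANTS**: `∃ δ₁ > 0, C₁ ≥ 0` (functions of `d` only) with
`|gaugeDev j (z,w)| ≤ C₁ · pref4inv(L^j)₃ · (L^j)^{−(d+1)} · e^{−(δ₁/2)·nbd_j(cube z, cube w)}` for all `k N L`, `j ≤ k`, `z w`.
[folklore] -/
theorem gaugeDev_le_349 :
    ∃ δ₁ C₁ : ℝ, 0 < δ₁ ∧ 0 ≤ C₁ ∧ ∀ (k N L : ℕ) [NeZero N] [NeZero L] (j : ℕ), j ≤ k →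
      ∀ z w : TPt (d + 1) (N * L ^ k) × Fin (d + 1),
        |gaugeDev d k N L j z w|
          ≤ C₁ * B9.pref4inv ((L : ℝ) ^ j) 3 * ((L : ℝ) ^ j) ^ (-((d + 1 : ℕ) : ℝ))
            * Real.exp (-(δ₁ / 2 * (nbd (d + 1) k N L j (cubeI (d + 1) k N L (Fin (d + 1)) j z)
                (cubeI (d + 1) k N L (Fin (d + 1)) j w) : ℝ))) := by
  obtain ⟨δ, C, hδ, hC, h⟩ := abs_gaugeDev_le d
  refine ⟨2 * (δ / (d + 1)), C, by positivity, hC, fun k N L _ _ j hj z w => ?_⟩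
  have hLpos : (0 : ℝ) < (L : ℝ) := by exact_mod_cast Nat.pos_of_ne_zero (NeZero.ne L)
  have hLj : (0 : ℝ) < (L : ℝ) ^ j := pow_pos hLpos j
  have hb := h k N L j hj z w
  rw [pref4inv_three, Real.rpow_neg hLj.le, Real.rpow_natCast, mul_div_cancel_left₀ _ (two_ne_zero)]
  calc |gaugeDev d k N L j z w| ≤ _ := hb
    _ = C * (((L : ℝ) ^ j)⁻¹ ^ 2) * (((L : ℝ) ^ j) ^ (d + 1))⁻¹
          * Real.exp (-(δ / (d + 1) * (nbd (d + 1) k N L j (cubeI (d + 1) k N L (Fin (d + 1)) j z)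
              (cubeI (d + 1) k N L (Fin (d + 1)) j w) : ℝ))) := by
        rw [inv_pow]; ring

/-- **(3.49) FOR THE FLAT REMAINDER FORM AT `U = 1` — PROVED, LEVEL-FREE.**  There are `δ₁ > 0` and `C₁ > 0` depending on the
dimension ONLY such that for ALL `k N L` (`N, L ≥ 1`), every level `j ≤ k` and all entries `(z,w)` of the NE3 carrier:
`|flatNg d k N L j z w| ≤ C₁ · pref4inv(L^j)₃ · (L^j)^{−(d+1)} · e^{−(δ₁/2)·nbd_j(cube z, cube w)}` — EXACTLY the hypothesis shape
of `SliceTorusBlockModel.ineq349_fineKernelOf_of_entryBounds` ∕ `SliceTorusTower.stmt349Printed_torus_of_entryBounds` at the item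
`n = 3` (the `Fk 3 = Ng` slot, binder `hF3`, of the one type `SliceCovariantLevels.ne3Shape_torusCovE_upto_of_printedStatements`)
with the block distance as site distance.  Gauge half: BRIDGE-126 + b05's (1.126); mass-deviation half: `abs_massDev_le_349`.
[folklore] -/
theorem flatNg_le_349 :
    ∃ δ₁ C₁ : ℝ, 0 < δ₁ ∧ 0 < C₁ ∧ ∀ (k N L : ℕ) [NeZero N] [NeZero L] (j : ℕ), j ≤ k →
      ∀ z w : TPt (d + 1) (N * L ^ k) × Fin (d + 1),
        |flatNg d k N L j z w|
          ≤ C₁ * B9.pref4inv ((L : ℝ) ^ j) 3 * ((L : ℝ) ^ j) ^ (-((d + 1 : ℕ) : ℝ))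
            * Real.exp (-(δ₁ / 2 * (nbd (d + 1) k N L j (cubeI (d + 1) k N L (Fin (d + 1)) j z)
                (cubeI (d + 1) k N L (Fin (d + 1)) j w) : ℝ))) := by
  obtain ⟨δ₁, C₁, hδ₁, hC₁, h⟩ := gaugeDev_le_349 d
  refine ⟨δ₁, C₁ + 2 * Real.exp (δ₁ / 2), hδ₁, by positivity, fun k N L _ _ j hj z w => ?_⟩
  have hLpos : (0 : ℝ) < (L : ℝ) := by exact_mod_cast Nat.pos_of_ne_zero (NeZero.ne L)
  have hLj : (0 : ℝ) < (L : ℝ) ^ j := pow_pos hLpos j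
  have hg := h k N L j hj z w
  have hm := abs_massDev_le_349 d k N L hj hδ₁.le z w
  set X := B9.pref4inv ((L : ℝ) ^ j) 3 * ((L : ℝ) ^ j) ^ (-((d + 1 : ℕ) : ℝ))
    * Real.exp (-(δ₁ / 2 * (nbd (d + 1) k N L j (cubeI (d + 1) k N L (Fin (d + 1)) j z)
        (cubeI (d + 1) k N L (Fin (d + 1)) j w) : ℝ))) with hX
  have hX0 : 0 ≤ X := by
    rw [hX, pref4inv_three]
    exact mul_nonneg (mul_nonneg (by positivity) (Real.rpow_nonneg hLj.le _)) (Real.exp_nonneg _)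
  rw [flatNg_eq_neg_gaugeDev_add_massDev]
  calc |(-gaugeDev d k N L j + massDev d k N L j) z w|
      = |-(gaugeDev d k N L j z w) + massDev d k N L j z w| := by rw [Matrix.add_apply, Matrix.neg_apply]
    _ ≤ |gaugeDev d k N L j z w| + |massDev d k N L j z w| := by
        have := abs_add_le (-(gaugeDev d k N L j z w)) (massDev d k N L j z w); rwa [abs_neg] at this
    _ ≤ C₁ * X + 2 * Real.exp (δ₁ / 2) * X := by
        refine add_le_add ?_ ?_
        · rw [hX, ← mul_assoc, ← mul_assoc]; exact hg
        · rw [hX, ← mul_assoc, ← mul_assoc]; exact hm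
    _ = (C₁ + 2 * Real.exp (δ₁ / 2)) * X := by ring
    _ = _ := by rw [hX, ← mul_assoc, ← mul_assoc]

end Shape

end Summit.QuantumFields.BalabanUV.T4Continuum.SliceFlatGaugeDecay
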